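import Literature.NumberTheory.LFunctions.Zhang2022.Section18Certificate

/-!
# Zhang (2022) §9, numerics lane (row N-02): the printed claims behind (9.8), second lineage

Trunk T-ANT (NumberTheory/LFunctions). Certified-numerics record for Y. Zhang, *Discrete mean
estimates and the Landau–Siegel zero*, arXiv:2211.02515v1 [Zhang2022LandauSiegel], §9 p. 52,
displays after (9.7) and (9.8) (tex L2670–2680 of the arXiv source):

> "Numerical calculation shows that `c₃₃ = 3.69507 + ε/2`, `c₃₄ = −0.4526 + 0.19474i + ε/√2`.
> It follows that `𝔠₂ < 6.9955`. (9.8)"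

with `|ε| < 10⁻⁵` (the convention of §8, tex L2566–2568), `c₃₃ = b₃₃ + b̄₃₃`, `c₃₄ = b₃₄ + b̄₄₃`,
`𝔠₂ = |ι₃|²c₃₃ + ι₃ῑ₄c₃₄ + ι₄ῑ₃c₄₃ + |ι₄|²c₄₄` and the integrals (9.3)–(9.6). The objects are those of
`Section18Defs` (`b33 … frakc2`, printed prefactor `((0.504)(0.498)π)⁻¹` in (9.5)/(9.6); `b34c …
frakc2c`, the `((0.5)(0.498)π)⁻¹` reading forced by `(log P₂)(log P₃)` in the display before (9.3)).
Nothing is re-defined here; (9.8) itself is the tree `Prop`s `Ineq98` / `Ineq98c` and is only CITED.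

**What this file records.** (1) Record theorems `n02_ineq98_verdict`, `n02_ineq98c_verdict`:
(9.8) is TRUE under both prefactor readings (kernel: `Section18Certificate.ineq98`, `ineq98c`),
with the kernel brackets, and — in the docstrings — the SECOND-LINEAGE enclosures of the
numerics lane (cell siegel-zhang, row N-02, kit job `j247184`: implementation A = python-flint/Arb
`acb.integral` rigorous quadrature of the printed integrands, implementation B = mpmath `iv`
exact antiderivatives of `c·zⁿ·e^{kπiz}` with hand-written complex interval pairs; 192-bit; the two
enclosures of all 139 quantities overlap, max width `6·10⁻⁵²`; all 33 tree brackets checked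
contain both). (2) The two "numerical calculation shows" claims for `c₃₃`, `c₃₄`, typed verbatim
in the shape of `Section8PrintedConstants.PrintedC11/PrintedC12` and DECIDED in the kernel from
the tree brackets: `c₃₃` TRUE; `c₃₄` FALSE with the printed prefactor (`|c₃₄ − printed| =
3.905·10⁻³` against `7.08·10⁻⁶`), TRUE with the `0.5` prefactor (`5.08·10⁻⁶`) — i.e. the printed
digits of `c₃₄` ARE the `0.5`-prefactor reading, and the `0.504` of (9.5)/(9.6) is a misprint that
is immaterial to (9.8). Planted-defect control of the lane (shift `0.002 → 0.003` in one
implementation only) was caught (12 disjoint boxes, (9.8) flips).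

Status of the source: an unrefereed manuscript under adjudication; nothing here is a claim about
Theorems 1–2 of the manuscript or about Landau–Siegel zeros — only about printed inequalities
between printed constants.
-/

noncomputable section

open Complex Real ComplexConjugate

namespace Literature.NumberTheory.LFunctions.Zhang2022.Numerics

open Literature.NumberTheory.LFunctions.Zhang2022

/-! ### (9.8) — record theorems (both prefactor readings) -/

/-- **N-02, (9.8) as printed** [Z22 p.52, (9.8), tex L2679]: "`𝔠₂ < 6.9955`" with the prefactor
`((0.504)(0.498)π)⁻¹` printed in (9.5)/(9.6) — TRUE, with the kernel bracket
`6.9949139 < 𝔠₂ < 6.9949141` (`Section18Certificate.ineq98`, `frakc2_re_bounds`).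
Second lineage (numerics lane N-02, kit `j247184`, implementations A = Arb quadrature / B = mpmath.iv
closed forms, both): `𝔠₂ ∈ [6.994913989654, 6.994913989655]`, margin `6.9955 − 𝔠₂ ∈
[5.86010345119·10⁻⁴, 5.86010345120·10⁻⁴]`; `b₃₃ = 1.847536294727… + 2.815680269648…i`,
`b₃₄ = −1.235608388549… + 0.000904516988…i`, `b₄₃ = 0.786595799375… − 0.192291864263…i`.
Verdict word: TRUE as printed. [cite: Zhang2022LandauSiegel, (9.8)] -/
theorem n02_ineq98_verdict :
    Ineq98 ∧ ((6.9949139 : ℝ) < frakc2.re ∧ frakc2.re < 6.9949141) :=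
  ⟨ineq98, frakc2_re_bounds⟩

/-- **N-02, (9.8) with the `0.5` prefactor** (`(log P₂)(log P₃) = (0.5)(0.498)log²P` in the display
before (9.3)): "`𝔠₂ < 6.9955`" — TRUE, kernel bracket `6.987092 < 𝔠₂ < 6.987093`
(`Section18Certificate.ineq98c`, `frakc2c_re_bounds`). Second lineage (N-02, kit `j247184`, both
implementations): `𝔠₂ ∈ [6.987092297781, 6.987092297782]`, margin `∈ [8.407702218069·10⁻³,
8.407702218070·10⁻³]`; `b₃₄ = −1.245493255657… + 0.000911753124…i`, `b₄₃ = 0.792888565770… −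
0.193830199177…i`. [cite: Zhang2022LandauSiegel, (9.8)] -/
theorem n02_ineq98c_verdict :
    Ineq98c ∧ ((6.987092 : ℝ) < frakc2c.re ∧ frakc2c.re < 6.987093) :=
  ⟨ineq98c, frakc2c_re_bounds⟩

/-! ### The two "numerical calculation shows" claims of §9, typed verbatim -/

/-- §9, display after (9.7) [Z22 p.52, tex L2672]: "Numerical calculation shows that
`c₃₃ = 3.69507 + ε/2`" with `|ε| < 10⁻⁵` (NUMERICS row N-02). TRUE: `n02_printedC33_num_holds`.
[claim: Zhang2022LandauSiegel, status: under-review] -/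
@[claim "Zhang2022LandauSiegel" "under-review"]
def n02_printedC33_num : Prop :=
  ∃ ε : ℂ, ‖ε‖ < 0.00001 ∧ c33 = ((3.69507 : ℝ) : ℂ) + ε / 2

/-- §9, display after (9.7) [Z22 p.52, tex L2675]: "`c₃₄ = −0.4526 + 0.19474i + ε/√2`" with
`|ε| < 10⁻⁵`, for `c₃₄` with the prefactor `((0.504)(0.498)π)⁻¹` PRINTED in (9.5)/(9.6)
(NUMERICS row N-02, reading "printed"). FALSE: `not_n02_printedC34_num`.
[claim: Zhang2022LandauSiegel, status: disputed] -/
@[claim "Zhang2022LandauSiegel" "disputed"]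
def n02_printedC34_num : Prop :=
  ∃ ε : ℂ, ‖ε‖ < 0.00001 ∧
    c34 = ((-0.4526 : ℝ) : ℂ) + ((0.19474 : ℝ) : ℂ) * I + ε / ((Real.sqrt 2 : ℝ) : ℂ)

/-- The same display for `c₃₄` with the prefactor `((0.5)(0.498)π)⁻¹` (tree `c34c`; NUMERICS row
N-02, reading "0.5-prefactor"). TRUE: `n02_printedC34c_num_holds` — the printed digits are this
reading. [claim: Zhang2022LandauSiegel, status: under-review] -/
@[claim "Zhang2022LandauSiegel" "under-review"]
def n02_printedC34c_num : Prop :=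
  ∃ ε : ℂ, ‖ε‖ < 0.00001 ∧
    c34c = ((-0.4526 : ℝ) : ℂ) + ((0.19474 : ℝ) : ℂ) * I + ε / ((Real.sqrt 2 : ℝ) : ℂ)

/-- **`c₃₃ = 3.69507 + ε/2` is CORRECT**: (9.3) gives `c₃₃ ∈ (3.695072, 3.695073)`
(`Section18Certificate.c33_re_bounds`, `c33_im`), so `ε = 2(c₃₃ − 3.69507)` works, `‖ε‖ < 6.2·10⁻⁶`.
Second lineage (N-02, kit `j247184`, both implementations): `c₃₃ ∈ [3.695072589454, 3.695072589455]`,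
`|c₃₃ − 3.69507| = 2.589·10⁻⁶ < 5·10⁻⁶`. [cite: Zhang2022LandauSiegel, §9 p. 52] -/
theorem n02_printedC33_num_holds : n02_printedC33_num := by
  have him := c33_im
  have hre := c33_re_bounds
  refine ⟨((2 * (c33.re - 3.69507) : ℝ) : ℂ), ?_, ?_⟩
  · rw [Complex.norm_real, Real.norm_eq_abs, abs_lt]
    constructor <;> linarith [hre.1, hre.2]
  · have h2 : ((2 * (c33.re - 3.69507) : ℝ) : ℂ) / 2 = ((c33.re - 3.69507 : ℝ) : ℂ) := by
      push_cast; ring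
    rw [h2]
    apply Complex.ext
    · simp
    · simp [him]

/-- Quantitative form of the `c₃₄` discrepancy under the printed prefactor: `Re c₃₄` is at distance
`> 0.00358` from the printed `−0.4526` (`Section18Certificate.c34_re_bounds`: `Re c₃₄ ∈
(−0.449013, −0.449012)`; second lineage `c₃₄ = −0.449012589173… + 0.193196381252…i`,
`|c₃₄ − (−0.4526 + 0.19474i)| = 3.905·10⁻³`, tolerance `10⁻⁵/√2 < 7.08·10⁻⁶`).
[cite: Zhang2022LandauSiegel, §9 p. 52] -/
theorem c34_re_printed_gap : 0.00358 < |c34.re - (-0.4526)| := by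
  have h := c34_re_bounds
  have h1 : 0.00358 < c34.re - (-0.4526) := by linarith [h.1]
  exact lt_of_lt_of_le h1 (le_abs_self _)

/-- **`c₃₄ = −0.4526 + 0.19474i + ε/√2` is FALSE for the printed prefactor** `((0.504)(0.498)π)⁻¹`:
real parts would force `|Re c₃₄ + 0.4526| ≤ ‖ε/√2‖ ≤ ‖ε‖ < 10⁻⁵`, against `c34_re_printed_gap`.
(Immaterial to (9.8), which holds under both readings: `n02_ineq98_verdict`.) Numerics lane N-02,
kit `j247184`. [cite: Zhang2022LandauSiegel, §9 p. 52] -/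
theorem not_n02_printedC34_num : ¬ n02_printedC34_num := by
  rintro ⟨ε, hε, heq⟩
  have hre : c34.re = -0.4526 + (ε / ((Real.sqrt 2 : ℝ) : ℂ)).re := by
    rw [heq]; simp
  have hs1 : (1 : ℝ) ≤ Real.sqrt 2 := by
    nlinarith [Real.sq_sqrt (by norm_num : (0:ℝ) ≤ 2), Real.sqrt_nonneg 2]
  have h1 : |(ε / ((Real.sqrt 2 : ℝ) : ℂ)).re| ≤ ‖ε‖ := by
    calc |(ε / ((Real.sqrt 2 : ℝ) : ℂ)).re| ≤ ‖ε / ((Real.sqrt 2 : ℝ) : ℂ)‖ := Complex.abs_re_le_norm _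
      _ = ‖ε‖ / Real.sqrt 2 := by
          rw [norm_div, Complex.norm_real, Real.norm_eq_abs, abs_of_pos (by positivity)]
      _ ≤ ‖ε‖ := div_le_self (norm_nonneg _) hs1
  have hgap := c34_re_printed_gap
  have h2 : |c34.re - (-0.4526)| = |(ε / ((Real.sqrt 2 : ℝ) : ℂ)).re| := by
    rw [hre]; ring_nf
  linarith

/-- **`c₃₄ = −0.4526 + 0.19474i + ε/√2` is TRUE for the `0.5` prefactor**: the tree brackets
`Section18Certificate.c34c_re_bounds` (`Re ∈ (−0.452605, −0.452604)`) and `c34c_im_bounds`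
(`Im ∈ (0.194741, 0.194742)`) give `‖c₃₄ − (−0.4526 + 0.19474i)‖² < 29·10⁻¹²`, so
`ε = √2·(c₃₄ − printed)` has `‖ε‖² < 5.8·10⁻¹¹ < 10⁻¹⁰`. Second lineage (N-02, kit `j247184`, both
implementations): `c₃₄ = −0.452604689886… + 0.194741952302…i`, `|c₃₄ − printed| = 5.08·10⁻⁶ <
7.07·10⁻⁶`. [cite: Zhang2022LandauSiegel, §9 p. 52] -/
theorem n02_printedC34c_num_holds : n02_printedC34c_num := by
  have hre := c34c_re_bounds
  have him := c34c_im_bounds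
  set p : ℂ := ((-0.4526 : ℝ) : ℂ) + ((0.19474 : ℝ) : ℂ) * I with hp
  have hs0 : (0 : ℝ) < Real.sqrt 2 := by positivity
  have hsC : ((Real.sqrt 2 : ℝ) : ℂ) ≠ 0 := by exact_mod_cast hs0.ne'
  refine ⟨((Real.sqrt 2 : ℝ) : ℂ) * (c34c - p), ?_, ?_⟩
  · -- ‖√2 (c34c − p)‖² = 2 ‖c34c − p‖² = 2 ((Re − (−0.4526))² + (Im − 0.19474)²) < 10⁻¹⁰
    have hdr : (c34c - p).re = c34c.re - (-0.4526) := by simp [hp]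
    have hdi : (c34c - p).im = c34c.im - 0.19474 := by simp [hp]
    have hn2 : ‖c34c - p‖ ^ 2 = (c34c.re - (-0.4526)) ^ 2 + (c34c.im - 0.19474) ^ 2 := by
      rw [Complex.sq_norm, Complex.normSq_apply, hdr, hdi]; ring
    have hsq : ‖c34c - p‖ ^ 2 < 2.9e-11 := by
      rw [hn2]; nlinarith [hre.1, hre.2, him.1, him.2]
    have hnorm : ‖((Real.sqrt 2 : ℝ) : ℂ) * (c34c - p)‖ = Real.sqrt 2 * ‖c34c - p‖ := by
      rw [norm_mul, Complex.norm_real, Real.norm_eq_abs, abs_of_pos hs0]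
    rw [hnorm]
    have h2 : (Real.sqrt 2 * ‖c34c - p‖) ^ 2 < 1e-10 := by
      rw [mul_pow, Real.sq_sqrt (by norm_num : (0:ℝ) ≤ 2)]; linarith
    have hnn : 0 ≤ Real.sqrt 2 * ‖c34c - p‖ := mul_nonneg hs0.le (norm_nonneg _)
    nlinarith [h2, hnn]
  · field_simp
    ring

/-- **Adjudication summary of the §9 numerical step** [Z22 p.52, tex L2670–2680], numerics lane
row N-02 (cell siegel-zhang, kit `j247184`, two code-disjoint implementations agreeing with the
tree's kernel certificates): (9.8) holds under both prefactor readings; of the two "numerical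
calculation shows" claims, `c₃₃` holds and `c₃₄` holds exactly under the `0.5`-prefactor reading
(and fails under the printed `0.504`). [cite: Zhang2022LandauSiegel, (9.8)] -/
theorem n02_summary :
    Ineq98 ∧ Ineq98c ∧ n02_printedC33_num ∧ ¬ n02_printedC34_num ∧ n02_printedC34c_num :=
  ⟨ineq98, ineq98c, n02_printedC33_num_holds, not_n02_printedC34_num, n02_printedC34c_num_holds⟩

end Literature.NumberTheory.LFunctions.Zhang2022.Numerics
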